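import Literature.NumberTheory.Automorphic.SymplecticGroupIwasawaExponents
import HarnessLib

/-!
# The Siegel parabolic of `Sp_{2n}(K)`: the `inr`-block Levi projection `P_S → GL_n(K)`, the Levi lift
# `GL_n(K) → Sp_{2n}(K)`, integrality, and the diagonal of Borel elements (Satake 1963 §7; Cartier 1979 §IV;
# Andrianov–Zhuravlev Ch. 1 §3, Ch. 3 §3)

Topic `NumberTheory/Automorphic`; namespace `Literature.NumberTheory.Automorphic.SymplecticCartan` (lane `lit-hodgefound`,
Track 2 foundations; seat `lit-hodgefound-p11`, generation 50, row g50-#1).  DEFINITIONS with bodies (`siegelBlockLabel`,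
`symplecticSiegelParabolic`, `siegelBlockGL`, `siegelLeviLift`, `borelRep`) + theorems; no named fact, no instance, no notation.
The `Sp_{2n}` analogue of `HyperspecialUnitaryParabolicBlocks` (g48-#2), written for Mathlib's `symplecticGroup (Fin n) K`
(form `J = (0 -1; 1 0)` on `K^{n ⊔ n}`) and the tree's Borel subgroup `symplecticBorel` (`SymplecticGroupIwasawa`: upper
triangular for the Borel order `inr 0 < ⋯ < inr (n-1) < inl (n-1) < ⋯ < inl 0`, i.e. `(A 0; C D)` in the `(inl, inr)` display
with `D` upper and `A = ᵗD⁻¹` lower triangular).  It is the block bookkeeping behind the SIEGEL DESCENT of the Satake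
transform of `Sp_{2n}` to its Levi subgroup `GL_n` (sequel `SymplecticSatakeSiegelDescent`): Cartier's transitivity
`S^G = S^M ∘ r^G_M` of the Satake transform along a parabolic `P = M N` ([CartierCorvallis1979] §IV, proof of Thm. 4.1 (b)),
for the Siegel parabolic `P_S = {(A 0; C D)} ⊇ B` with Levi `M = {m(D) = (ᵗD⁻¹ 0; 0 D)} ≅ GL_n`.

## The mathematics

For `g = (A B; C D) ∈ Sp(J, K)` (blocks along `inl ⊕ inr`): `g ∈ P_S :⟺ B = 0`; then `A ᵗD = 1` ([AndrianovZhuravlev1995]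
Ch. 1 §3 (3.5)–(3.7)), `P_S` is a subgroup containing `B(K)`, and `g ↦ D` is a HOMOMORPHISM `P_S → GL_n(K)` (the `(inr, inr)`
block of a product `g g'` with `B' = 0` is `D D'`).  Conversely `m(D) = (ᵗD⁻¹ 0; 0 D) ∈ P_S` for every `D ∈ GL_n(K)`, with
`D`-block `D`; `m(D) ∈ Sp(J, 𝒪)` when `D` and `D⁻¹` are integral; the `D`-block of an element of `Sp(J, 𝒪) ∩ P_S` is integral
with integral inverse.  For a Borel element `p ∈ B(K)` the block `D(p)` is upper triangular and its diagonal satisfies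
`p_{inr i, inr i} · p_{inl i, inl i} = 1`, so `v(p_{inr i, inr i}) = exp(a(p)ᵢ)` where `a(p)ᵢ = ord p_{inl i, inl i}` is the
tree's Iwasawa exponent (`symplecticIwasawaExp`): the exponents of `Sp_{2n}` are MINUS the `GL_n` exponents of the `D`-block —
the dictionary used by the descent.

## What is formalised

* §1 `siegelBlockLabel` (`inr ↦ 0`, `inl ↦ 1`), `blockTriangular_siegelBlockLabel_iff`, **`symplecticSiegelParabolic n K`**
  (`P_S ≤ Sp(J, K)`), `mem_symplecticSiegelParabolic_iff` (`B = 0`), `symplecticBorel_le_symplecticSiegelParabolic`,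
  `apply_inl_inr_eq_zero_of_mem_symplecticBorel`.
* §2 `toBlocks₂₂_mul_of_apply_inl_inr_eq_zero` (`D(g g') = D(g) D(g')` when `B' = 0`), `toBlocks₂₂_one`,
  **`siegelBlockGL n K : symplecticSiegelParabolic n K →* GL (Fin n) K`**, `coe_siegelBlockGL`, `coe_siegelBlockGL_inv`,
  `siegelBlockGL_apply` (entries), `blockTriangular_siegelBlockGL_of_mem_symplecticBorel` (`D(p)` is upper triangular for
  `p ∈ B(K)`), `siegelBlockGL_apply_self_mul_apply_inl` (`D(p)_{ii} p_{inl i, inl i} = 1`).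
* §3 **`siegelLeviLift n K : GL (Fin n) K →* symplecticGroup (Fin n) K`** (`D ↦ (ᵗD⁻¹ 0; 0 D)`), `coe_siegelLeviLift`,
  `siegelLeviLift_mem_symplecticSiegelParabolic`, `siegelBlockGL_siegelLeviLift` (`D(m(D)) = D`), entry lemmas.
* §4 (valued `K`) **`borelRep`** (a chosen Borel representative `b_γ` of a coset `γ ∈ Sp(J,K)/Sp(J,𝒪)`), `borelRep_mem`,
  `mk_borelRep`, `symplecticIwasawaExp_out_eq_borelRep`; `v_siegelBlockGL_le_one` (integrality on `Sp(J, 𝒪) ∩ P_S`), `siegelLeviLift_mem_symplecticInt`,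
  **`v_siegelBlockGL_apply_self`** (`v(D(p)_{ii}) = exp(a(p)ᵢ)` for `p ∈ B(K)`).

## References
* [Satake1963] I. Satake, *Theory of spherical functions on reductive algebraic groups over 𝔭-adic fields*, Publ. Math. IHÉS 18
  (1963), §7 (the symplectic group), §8.
* [CartierCorvallis1979] P. Cartier, *Representations of 𝔭-adic groups: a survey*, PSPM 33.1 (1979), §IV (4.2), proof of Thm. 4.1 (b).
* [AndrianovZhuravlev1995] A. N. Andrianov, V. G. Zhuravlev, *Modular Forms and Hecke Operators*, Transl. Math. Monogr. 145 (1995),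
  Ch. 1 §3 (3.5)–(3.7), Prop. 3.7; Ch. 3 §3 Lemma 3.4.
* [BruhatTits1972] F. Bruhat, J. Tits, *Groupes réductifs sur un corps local I*, Publ. Math. IHÉS 41 (1972), (4.4.3).
-/

noncomputable section

open scoped Valued WithZero MatrixGroups
open Matrix

namespace Literature.NumberTheory.Automorphic.SymplecticCartan

open Literature.NumberTheory.Automorphic.HermitianLattice

variable {K : Type*} [Field K] {n : ℕ}

/-! ## §1 The Siegel parabolic `P_S(K) ≤ Sp(J, K)` -/

/-- The **Siegel block label** of the standard basis of `K^{n ⊔ n}`: `inr i ↦ 0`, `inl i ↦ 1` (the Lagrangian `⟨e_{inr i}⟩_i`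
comes first, as in the Borel order). [cite: AndrianovZhuravlev1995, Ch. 1 §3 Prop. 3.7] -/
def siegelBlockLabel (n : ℕ) : Fin n ⊕ Fin n → ℕ :=
  Sum.elim (fun _ => 1) (fun _ => 0)

/-- `ℓ(inl i) = 1`. [cite: AndrianovZhuravlev1995, Ch. 1 §3 Prop. 3.7] -/
@[simp] theorem siegelBlockLabel_inl (i : Fin n) : siegelBlockLabel n (Sum.inl i) = 1 := rfl

/-- `ℓ(inr i) = 0`. [cite: AndrianovZhuravlev1995, Ch. 1 §3 Prop. 3.7] -/
@[simp] theorem siegelBlockLabel_inr (i : Fin n) : siegelBlockLabel n (Sum.inr i) = 0 := rfl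

/-- **Block upper triangularity for the Siegel label is the vanishing of the `(inl, inr)` block** `B = 0`.
[cite: AndrianovZhuravlev1995, Ch. 1 §3 Prop. 3.7] -/
theorem blockTriangular_siegelBlockLabel_iff {R : Type*} [Zero R] (M : Matrix (Fin n ⊕ Fin n) (Fin n ⊕ Fin n) R) :
    M.BlockTriangular (siegelBlockLabel n) ↔ ∀ i j, M (Sum.inl i) (Sum.inr j) = 0 := by
  constructor
  · intro h i j
    exact h (by rw [siegelBlockLabel_inr, siegelBlockLabel_inl]; exact Nat.zero_lt_one)
  · rintro h (i | i) (j | j) hij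
    · exact absurd hij (lt_irrefl _)
    · exact h i j
    · rw [siegelBlockLabel_inl, siegelBlockLabel_inr] at hij
      exact absurd hij (Nat.not_lt_zero _)
    · exact absurd hij (lt_irrefl _)

/-- **The Siegel parabolic `P_S(K) ≤ Sp(J, K)`**: the stabiliser of the Lagrangian `⟨e_{inr i}⟩_i`, i.e. the symplectic matrices
`(A 0; C D)` (`B = 0` in the `(inl, inr)` display); Levi `{(ᵗD⁻¹ 0; 0 D)} ≅ GL_n(K)`, unipotent radical `{(1 0; C 1) : ᵗC = C}`.
[cite: AndrianovZhuravlev1995, Ch. 1 §3 Prop. 3.7] [cite: Satake1963, §7] -/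
def symplecticSiegelParabolic (n : ℕ) (K : Type*) [Field K] : Subgroup (symplecticGroup (Fin n) K) where
  carrier := {g | (g : Matrix (Fin n ⊕ Fin n) (Fin n ⊕ Fin n) K).BlockTriangular (siegelBlockLabel n)}
  mul_mem' {a b} ha hb := by
    change ((a * b : symplecticGroup (Fin n) K) : Matrix (Fin n ⊕ Fin n) (Fin n ⊕ Fin n) K).BlockTriangular _
    exact Matrix.BlockTriangular.mul ha hb
  one_mem' := by
    change ((1 : symplecticGroup (Fin n) K) : Matrix (Fin n ⊕ Fin n) (Fin n ⊕ Fin n) K).BlockTriangular _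
    exact Matrix.blockTriangular_one
  inv_mem' {a} ha := by
    change ((a⁻¹ : symplecticGroup (Fin n) K) : Matrix (Fin n ⊕ Fin n) (Fin n ⊕ Fin n) K).BlockTriangular _
    rw [SymplecticGroup.coe_inv']
    haveI := Matrix.invertibleOfIsUnitDet _ (SymplecticGroup.symplectic_det a.2)
    exact Matrix.blockTriangular_inv_of_blockTriangular ha

/-- Membership in `P_S`: the `(inl, inr)` block vanishes. [cite: AndrianovZhuravlev1995, Ch. 1 §3 Prop. 3.7] -/
theorem mem_symplecticSiegelParabolic_iff {g : symplecticGroup (Fin n) K} :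
    g ∈ symplecticSiegelParabolic n K ↔ ∀ i j, (g : Matrix (Fin n ⊕ Fin n) (Fin n ⊕ Fin n) K) (Sum.inl i) (Sum.inr j) = 0 :=
  blockTriangular_siegelBlockLabel_iff _

/-- `B(K) ≤ P_S(K)`: Borel elements are `(A 0; C D)`. [cite: AndrianovZhuravlev1995, Ch. 1 §3 Prop. 3.7; Ch. 3 §3 Lemma 3.4] -/
theorem symplecticBorel_le_symplecticSiegelParabolic : symplecticBorel n K ≤ symplecticSiegelParabolic n K :=
  fun _ hg => mem_symplecticSiegelParabolic_iff.2 ((blockTriangular_symplecticBorelOrder_iff _).1 (mem_symplecticBorel_iff.1 hg)).1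

/-- The `(inl, inr)` block of a Borel element vanishes. [cite: AndrianovZhuravlev1995, Ch. 3 §3 Lemma 3.4] -/
theorem apply_inl_inr_eq_zero_of_mem_symplecticBorel {p : symplecticGroup (Fin n) K} (hp : p ∈ symplecticBorel n K)
    (i j : Fin n) : (p : Matrix (Fin n ⊕ Fin n) (Fin n ⊕ Fin n) K) (Sum.inl i) (Sum.inr j) = 0 :=
  mem_symplecticSiegelParabolic_iff.1 (symplecticBorel_le_symplecticSiegelParabolic hp) i j

/-! ## §2 The Levi projection `P_S → GL_n(K)` onto the `(inr, inr)` block -/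

omit [Field K] in
/-- Entries of the `(inr, inr)` block. [cite: AndrianovZhuravlev1995, Ch. 1 §3 (3.5)] -/
theorem toBlocks₂₂_apply' {R : Type*} (M : Matrix (Fin n ⊕ Fin n) (Fin n ⊕ Fin n) R) (i j : Fin n) :
    M.toBlocks₂₂ i j = M (Sum.inr i) (Sum.inr j) := rfl

/-- **The `D`-block is multiplicative against `P_S`**: `D(M M') = D(M) D(M')` as soon as `B' = 0`.
[cite: AndrianovZhuravlev1995, Ch. 1 §3 Prop. 3.7] [cite: CartierCorvallis1979, §IV (4.2)] -/
theorem toBlocks₂₂_mul_of_apply_inl_inr_eq_zero (M M' : Matrix (Fin n ⊕ Fin n) (Fin n ⊕ Fin n) K)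
    (hM' : ∀ i j, M' (Sum.inl i) (Sum.inr j) = 0) : (M * M').toBlocks₂₂ = M.toBlocks₂₂ * M'.toBlocks₂₂ := by
  ext i j
  simp only [toBlocks₂₂_apply', Matrix.mul_apply, Fintype.sum_sum_type, hM', mul_zero, Finset.sum_const_zero, zero_add]

/-- `D(1) = 1`. [cite: AndrianovZhuravlev1995, Ch. 1 §3 Prop. 3.7] -/
theorem toBlocks₂₂_one : (1 : Matrix (Fin n ⊕ Fin n) (Fin n ⊕ Fin n) K).toBlocks₂₂ = 1 := by
  ext i j
  rw [toBlocks₂₂_apply']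
  by_cases h : i = j
  · rw [h, Matrix.one_apply_eq, Matrix.one_apply_eq]
  · rw [Matrix.one_apply_ne (fun h' => h (Sum.inr_injective h')), Matrix.one_apply_ne h]

/-- Coercion of a product in `P_S` to matrices. [folklore] -/
private theorem coe_coe_mul (q q' : symplecticSiegelParabolic n K) :
    (((q * q' : symplecticSiegelParabolic n K) : symplecticGroup (Fin n) K) : Matrix (Fin n ⊕ Fin n) (Fin n ⊕ Fin n) K) =
      ((q : symplecticGroup (Fin n) K) : Matrix (Fin n ⊕ Fin n) (Fin n ⊕ Fin n) K) *
        ((q' : symplecticGroup (Fin n) K) : Matrix (Fin n ⊕ Fin n) (Fin n ⊕ Fin n) K) := by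
  rw [Subgroup.coe_mul, Submonoid.coe_mul]

/-- Coercion of `1 ∈ P_S` to matrices. [folklore] -/
private theorem coe_coe_one :
    (((1 : symplecticSiegelParabolic n K) : symplecticGroup (Fin n) K) : Matrix (Fin n ⊕ Fin n) (Fin n ⊕ Fin n) K) = 1 := by
  rw [Subgroup.coe_one]; rfl

/-- **The Levi projection `P_S(K) → GL_n(K)`, `(A 0; C D) ↦ D`** (a group homomorphism; the inverse of `D(q)` is `D(q⁻¹)`).
[cite: AndrianovZhuravlev1995, Ch. 1 §3 Prop. 3.7] [cite: Satake1963, §7] [cite: BruhatTits1972, (4.4.3)] -/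
def siegelBlockGL (n : ℕ) (K : Type*) [Field K] : symplecticSiegelParabolic n K →* GL (Fin n) K where
  toFun q := ⟨((q : symplecticGroup (Fin n) K) : Matrix (Fin n ⊕ Fin n) (Fin n ⊕ Fin n) K).toBlocks₂₂,
    (((q⁻¹ : symplecticSiegelParabolic n K) : symplecticGroup (Fin n) K) : Matrix (Fin n ⊕ Fin n) (Fin n ⊕ Fin n) K).toBlocks₂₂,
    by rw [← toBlocks₂₂_mul_of_apply_inl_inr_eq_zero _ _ (mem_symplecticSiegelParabolic_iff.1 (q⁻¹).2), ← coe_coe_mul,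
      mul_inv_cancel, coe_coe_one, toBlocks₂₂_one],
    by rw [← toBlocks₂₂_mul_of_apply_inl_inr_eq_zero _ _ (mem_symplecticSiegelParabolic_iff.1 q.2), ← coe_coe_mul,
      inv_mul_cancel, coe_coe_one, toBlocks₂₂_one]⟩
  map_one' := Units.ext (by
    change (((1 : symplecticSiegelParabolic n K) : symplecticGroup (Fin n) K) : Matrix (Fin n ⊕ Fin n) (Fin n ⊕ Fin n) K).toBlocks₂₂ = 1
    rw [coe_coe_one, toBlocks₂₂_one])
  map_mul' q q' := Units.ext (by
    change (((q * q' : symplecticSiegelParabolic n K) : symplecticGroup (Fin n) K) : Matrix (Fin n ⊕ Fin n) (Fin n ⊕ Fin n) K).toBlocks₂₂ =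
      ((q : symplecticGroup (Fin n) K) : Matrix (Fin n ⊕ Fin n) (Fin n ⊕ Fin n) K).toBlocks₂₂ *
        ((q' : symplecticGroup (Fin n) K) : Matrix (Fin n ⊕ Fin n) (Fin n ⊕ Fin n) K).toBlocks₂₂
    rw [coe_coe_mul]
    exact toBlocks₂₂_mul_of_apply_inl_inr_eq_zero _ _ (mem_symplecticSiegelParabolic_iff.1 q'.2))

/-- The matrix of `siegelBlockGL q` is the `(inr, inr)` block of `q`. [cite: AndrianovZhuravlev1995, Ch. 1 §3 Prop. 3.7] -/
@[simp] theorem coe_siegelBlockGL (q : symplecticSiegelParabolic n K) :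
    ((siegelBlockGL n K q : GL (Fin n) K) : Matrix (Fin n) (Fin n) K) =
      ((q : symplecticGroup (Fin n) K) : Matrix (Fin n ⊕ Fin n) (Fin n ⊕ Fin n) K).toBlocks₂₂ :=
  rfl

/-- Entries of `siegelBlockGL q`: `D(q)_{ij} = q_{inr i, inr j}`. [cite: AndrianovZhuravlev1995, Ch. 1 §3 Prop. 3.7] -/
theorem siegelBlockGL_apply (q : symplecticSiegelParabolic n K) (i j : Fin n) :
    ((siegelBlockGL n K q : GL (Fin n) K) : Matrix (Fin n) (Fin n) K) i j =
      ((q : symplecticGroup (Fin n) K) : Matrix (Fin n ⊕ Fin n) (Fin n ⊕ Fin n) K) (Sum.inr i) (Sum.inr j) :=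
  rfl

/-- The matrix of `(siegelBlockGL q)⁻¹` is the `(inr, inr)` block of `q⁻¹`. [cite: AndrianovZhuravlev1995, Ch. 1 §3 Prop. 3.7] -/
theorem coe_siegelBlockGL_inv (q : symplecticSiegelParabolic n K) :
    (((siegelBlockGL n K q)⁻¹ : GL (Fin n) K) : Matrix (Fin n) (Fin n) K) =
      (((q : symplecticGroup (Fin n) K)⁻¹ : symplecticGroup (Fin n) K) : Matrix (Fin n ⊕ Fin n) (Fin n ⊕ Fin n) K).toBlocks₂₂ := by
  rw [← map_inv, coe_siegelBlockGL, Subgroup.coe_inv]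

/-- **For a Borel element `p`, `D(p)` is upper triangular** (the `(inr, inr)` block of a matrix upper triangular for the Borel
order). [cite: AndrianovZhuravlev1995, Ch. 3 §3 Lemma 3.4] [cite: BruhatTits1972, (4.4.3)] -/
theorem blockTriangular_siegelBlockGL_of_mem_symplecticBorel {p : symplecticGroup (Fin n) K} (hp : p ∈ symplecticBorel n K) :
    ((siegelBlockGL n K ⟨p, symplecticBorel_le_symplecticSiegelParabolic hp⟩ : GL (Fin n) K) : Matrix (Fin n) (Fin n) K).BlockTriangular
      id := by
  intro i j hij
  rw [siegelBlockGL_apply]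
  exact ((blockTriangular_symplecticBorelOrder_iff _).1 (mem_symplecticBorel_iff.1 hp)).2.1 i j hij

/-- On the Borel subgroup the diagonals of the two blocks are inverse to each other: `D(p)_{ii} · p_{inl i, inl i} = 1`.
[cite: AndrianovZhuravlev1995, Ch. 3 §3.3 (3.44)] -/
theorem siegelBlockGL_apply_self_mul_apply_inl {p : symplecticGroup (Fin n) K} (hp : p ∈ symplecticBorel n K) (i : Fin n) :
    ((siegelBlockGL n K ⟨p, symplecticBorel_le_symplecticSiegelParabolic hp⟩ : GL (Fin n) K) : Matrix (Fin n) (Fin n) K) i i *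
        (p : Matrix (Fin n ⊕ Fin n) (Fin n ⊕ Fin n) K) (Sum.inl i) (Sum.inl i) = 1 := by
  rw [siegelBlockGL_apply]
  exact apply_inr_mul_apply_inl_eq_one hp i

/-! ## §3 The Levi lift `m : GL_n(K) → Sp(J, K)`, `D ↦ (ᵗD⁻¹ 0; 0 D)` -/

/-- `ᵗ(D⁻¹) D`-bookkeeping: `(ᵗ(D⁻¹))ᵀ D = 1`. [folklore] -/
private theorem transpose_transpose_inv_mul (D : GL (Fin n) K) :
    ((((D⁻¹ : GL (Fin n) K) : Matrix (Fin n) (Fin n) K)ᵀ)ᵀ) * (D : Matrix (Fin n) (Fin n) K) = 1 := by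
  rw [Matrix.transpose_transpose, ← Units.val_mul, inv_mul_cancel, Units.val_one]

/-- The block matrix `(ᵗD⁻¹ 0; 0 D)` is symplectic. [cite: AndrianovZhuravlev1995, Ch. 1 §3 Prop. 3.7] -/
theorem fromBlocks_transpose_inv_mem_symplecticGroup (D : GL (Fin n) K) :
    Matrix.fromBlocks (((D⁻¹ : GL (Fin n) K) : Matrix (Fin n) (Fin n) K)ᵀ) 0 0 (D : Matrix (Fin n) (Fin n) K) ∈
      symplecticGroup (Fin n) K := by
  rw [SymplecticGroup.fromBlocks_mem_iff]
  refine ⟨by rw [Matrix.mul_zero, Matrix.transpose_zero, Matrix.zero_mul], by rw [Matrix.mul_zero, Matrix.transpose_zero,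
    Matrix.zero_mul], ?_⟩
  rw [Matrix.transpose_zero, Matrix.zero_mul, sub_zero, transpose_transpose_inv_mul]

/-- **The Levi lift `m : GL_n(K) →* Sp(J, K)`, `m(D) = (ᵗD⁻¹ 0; 0 D)`** (the Levi factor of the Siegel parabolic).
[cite: AndrianovZhuravlev1995, Ch. 1 §3 Prop. 3.7] [cite: Satake1963, §7] -/
def siegelLeviLift (n : ℕ) (K : Type*) [Field K] : GL (Fin n) K →* symplecticGroup (Fin n) K where
  toFun D := ⟨Matrix.fromBlocks (((D⁻¹ : GL (Fin n) K) : Matrix (Fin n) (Fin n) K)ᵀ) 0 0 (D : Matrix (Fin n) (Fin n) K),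
    fromBlocks_transpose_inv_mem_symplecticGroup D⟩
  map_one' := Subtype.ext (by
    change Matrix.fromBlocks ((((1 : GL (Fin n) K)⁻¹ : GL (Fin n) K) : Matrix (Fin n) (Fin n) K)ᵀ) 0 0
      ((1 : GL (Fin n) K) : Matrix (Fin n) (Fin n) K) = 1
    rw [inv_one, Units.val_one, Matrix.transpose_one, Matrix.fromBlocks_one])
  map_mul' D D' := Subtype.ext (by
    change Matrix.fromBlocks ((((D * D')⁻¹ : GL (Fin n) K) : Matrix (Fin n) (Fin n) K)ᵀ) 0 0 ((D * D' : GL (Fin n) K) : Matrix (Fin n) (Fin n) K) =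
      Matrix.fromBlocks (((D⁻¹ : GL (Fin n) K) : Matrix (Fin n) (Fin n) K)ᵀ) 0 0 (D : Matrix (Fin n) (Fin n) K) *
        Matrix.fromBlocks (((D'⁻¹ : GL (Fin n) K) : Matrix (Fin n) (Fin n) K)ᵀ) 0 0 (D' : Matrix (Fin n) (Fin n) K)
    rw [Matrix.fromBlocks_multiply]
    simp only [Matrix.mul_zero, Matrix.zero_mul, add_zero, zero_add]
    rw [_root_.mul_inv_rev, Units.val_mul, Units.val_mul, Matrix.transpose_mul])

/-- The matrix of `m(D)`. [cite: AndrianovZhuravlev1995, Ch. 1 §3 Prop. 3.7] -/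
theorem coe_siegelLeviLift (D : GL (Fin n) K) :
    ((siegelLeviLift n K D : symplecticGroup (Fin n) K) : Matrix (Fin n ⊕ Fin n) (Fin n ⊕ Fin n) K) =
      Matrix.fromBlocks (((D⁻¹ : GL (Fin n) K) : Matrix (Fin n) (Fin n) K)ᵀ) 0 0 (D : Matrix (Fin n) (Fin n) K) :=
  rfl

/-- `m(D)_{inr i, inr j} = D_{ij}`. [cite: AndrianovZhuravlev1995, Ch. 1 §3 Prop. 3.7] -/
theorem siegelLeviLift_apply_inr_inr (D : GL (Fin n) K) (i j : Fin n) :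
    ((siegelLeviLift n K D : symplecticGroup (Fin n) K) : Matrix (Fin n ⊕ Fin n) (Fin n ⊕ Fin n) K) (Sum.inr i) (Sum.inr j) =
      (D : Matrix (Fin n) (Fin n) K) i j := by
  rw [coe_siegelLeviLift, Matrix.fromBlocks_apply₂₂]

/-- `m(D)_{inl i, inl j} = (D⁻¹)_{ji}`. [cite: AndrianovZhuravlev1995, Ch. 1 §3 Prop. 3.7] -/
theorem siegelLeviLift_apply_inl_inl (D : GL (Fin n) K) (i j : Fin n) :
    ((siegelLeviLift n K D : symplecticGroup (Fin n) K) : Matrix (Fin n ⊕ Fin n) (Fin n ⊕ Fin n) K) (Sum.inl i) (Sum.inl j) =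
      ((D⁻¹ : GL (Fin n) K) : Matrix (Fin n) (Fin n) K) j i := by
  rw [coe_siegelLeviLift, Matrix.fromBlocks_apply₁₁, Matrix.transpose_apply]

/-- `m(D)_{inl i, inr j} = 0`. [cite: AndrianovZhuravlev1995, Ch. 1 §3 Prop. 3.7] -/
theorem siegelLeviLift_apply_inl_inr (D : GL (Fin n) K) (i j : Fin n) :
    ((siegelLeviLift n K D : symplecticGroup (Fin n) K) : Matrix (Fin n ⊕ Fin n) (Fin n ⊕ Fin n) K) (Sum.inl i) (Sum.inr j) = 0 := by
  rw [coe_siegelLeviLift, Matrix.fromBlocks_apply₁₂, Matrix.zero_apply]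

/-- `m(D)_{inr i, inl j} = 0`. [cite: AndrianovZhuravlev1995, Ch. 1 §3 Prop. 3.7] -/
theorem siegelLeviLift_apply_inr_inl (D : GL (Fin n) K) (i j : Fin n) :
    ((siegelLeviLift n K D : symplecticGroup (Fin n) K) : Matrix (Fin n ⊕ Fin n) (Fin n ⊕ Fin n) K) (Sum.inr i) (Sum.inl j) = 0 := by
  rw [coe_siegelLeviLift, Matrix.fromBlocks_apply₂₁, Matrix.zero_apply]

/-- `m(D) ∈ P_S`. [cite: AndrianovZhuravlev1995, Ch. 1 §3 Prop. 3.7] -/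
theorem siegelLeviLift_mem_symplecticSiegelParabolic (D : GL (Fin n) K) :
    siegelLeviLift n K D ∈ symplecticSiegelParabolic n K :=
  mem_symplecticSiegelParabolic_iff.2 (siegelLeviLift_apply_inl_inr D)

/-- **`D(m(D)) = D`**: the Levi projection splits the Levi lift. [cite: AndrianovZhuravlev1995, Ch. 1 §3 Prop. 3.7] -/
theorem siegelBlockGL_siegelLeviLift (D : GL (Fin n) K) :
    siegelBlockGL n K ⟨siegelLeviLift n K D, siegelLeviLift_mem_symplecticSiegelParabolic D⟩ = D :=
  Units.ext (Matrix.ext fun i j => by rw [siegelBlockGL_apply]; exact siegelLeviLift_apply_inr_inr D i j)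

/-- `m(D) ∈ B(K)` when `D` is upper triangular (then `ᵗD⁻¹` is lower triangular). [cite: AndrianovZhuravlev1995, Ch. 3 §3 Lemma 3.4] -/
theorem siegelLeviLift_mem_symplecticBorel {D : GL (Fin n) K} (hD : (D : Matrix (Fin n) (Fin n) K).BlockTriangular id) :
    siegelLeviLift n K D ∈ symplecticBorel n K := by
  have hD' : ((D⁻¹ : GL (Fin n) K) : Matrix (Fin n) (Fin n) K).BlockTriangular id := by
    rw [Matrix.coe_units_inv]
    haveI := (D : Matrix (Fin n) (Fin n) K).invertibleOfIsUnitDet (Matrix.isUnits_det_units D)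
    exact Matrix.blockTriangular_inv_of_blockTriangular hD
  rw [mem_symplecticBorel_iff, blockTriangular_symplecticBorelOrder_iff]
  refine ⟨siegelLeviLift_apply_inl_inr D, fun i j hij => ?_, fun i j hij => ?_⟩
  · rw [siegelLeviLift_apply_inr_inr]; exact hD hij
  · rw [siegelLeviLift_apply_inl_inl]; exact hD' hij

/-! ## §4 Valued fields: integrality and the diagonal exponents -/

section Valued

variable [Valued K ℤᵐ⁰]

section BorelRep

variable {ϖ : K}

/-! ### Borel representatives of cosets of `Sp(J, 𝒪)` -/

/-- A chosen Borel representative `b_γ ∈ B(K)` of the coset `γ ∈ Sp(J, K)/Sp(J, 𝒪)` (Iwasawa decomposition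
`γ.out = b_γ k`, `k ∈ Sp(J, 𝒪)`). [cite: BruhatTits1972, (4.4.3)] [cite: CartierCorvallis1979, §IV (4.2)] -/
def borelRep (hϖ : Valued.v ϖ = WithZero.exp (-1 : ℤ)) (γ : symplecticGroup (Fin n) K ⧸ symplecticInt (Fin n) K) :
    symplecticGroup (Fin n) K :=
  (exists_mem_symplecticBorel_mul_symplecticInt hϖ γ.out).choose

/-- `b_γ ∈ B(K)`. [cite: BruhatTits1972, (4.4.3)] -/
theorem borelRep_mem (hϖ : Valued.v ϖ = WithZero.exp (-1 : ℤ)) (γ : symplecticGroup (Fin n) K ⧸ symplecticInt (Fin n) K) :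
    borelRep hϖ γ ∈ symplecticBorel n K :=
  (exists_mem_symplecticBorel_mul_symplecticInt hϖ γ.out).choose_spec.choose_spec.1

/-- `b_γ K₀ = γ`. [cite: BruhatTits1972, (4.4.3)] -/
theorem mk_borelRep (hϖ : Valued.v ϖ = WithZero.exp (-1 : ℤ)) (γ : symplecticGroup (Fin n) K ⧸ symplecticInt (Fin n) K) :
    (borelRep hϖ γ : symplecticGroup (Fin n) K ⧸ symplecticInt (Fin n) K) = γ := by
  obtain ⟨k, -, hk, h⟩ := (exists_mem_symplecticBorel_mul_symplecticInt hϖ γ.out).choose_spec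
  change γ.out = borelRep hϖ γ * k at h
  calc (borelRep hϖ γ : symplecticGroup (Fin n) K ⧸ symplecticInt (Fin n) K)
      = (γ.out : symplecticGroup (Fin n) K ⧸ symplecticInt (Fin n) K) :=
        QuotientGroup.eq.2 (by rw [h, inv_mul_cancel_left]; exact hk)
    _ = γ := QuotientGroup.out_eq' γ

/-- The Iwasawa exponents of a coset are those of its Borel representative. [cite: CartierCorvallis1979, §IV (4.2)] -/
theorem symplecticIwasawaExp_out_eq_borelRep (hϖ : Valued.v ϖ = WithZero.exp (-1 : ℤ))
    (γ : symplecticGroup (Fin n) K ⧸ symplecticInt (Fin n) K) :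
    symplecticIwasawaExp hϖ γ.out = symplecticIwasawaExp hϖ (borelRep hϖ γ) := by
  obtain ⟨k, -, hk, h⟩ := (exists_mem_symplecticBorel_mul_symplecticInt hϖ γ.out).choose_spec
  change γ.out = borelRep hϖ γ * k at h
  rw [h, symplecticIwasawaExp_mul_of_mem_symplecticInt hϖ _ hk]

end BorelRep


/-- **`Sp(J, 𝒪) ∩ P_S` projects to integral matrices with integral inverses** in `GL_n(K)`. [cite: BruhatTits1972, (4.4.3)]
[cite: CartierCorvallis1979, §IV.1] -/
theorem v_siegelBlockGL_le_one {q : symplecticSiegelParabolic n K} (hq : (q : symplecticGroup (Fin n) K) ∈ symplecticInt (Fin n) K) :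
    (∀ i j, Valued.v (((siegelBlockGL n K q : GL (Fin n) K) : Matrix (Fin n) (Fin n) K) i j) ≤ 1) ∧
      ∀ i j, Valued.v ((((siegelBlockGL n K q)⁻¹ : GL (Fin n) K) : Matrix (Fin n) (Fin n) K) i j) ≤ 1 := by
  refine ⟨fun i j => ?_, fun i j => ?_⟩
  · rw [siegelBlockGL_apply]; exact mem_symplecticInt_iff.1 hq _ _
  · rw [coe_siegelBlockGL_inv, toBlocks₂₂_apply']; exact v_inv_apply_le_one_of_mem_symplecticInt hq _ _

/-- **`m(D) ∈ Sp(J, 𝒪)` when `D` and `D⁻¹` are integral.** [cite: BruhatTits1972, (4.4.3)] [cite: CartierCorvallis1979, §IV.1] -/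
theorem siegelLeviLift_mem_symplecticInt {D : GL (Fin n) K} (h1 : ∀ i j, Valued.v ((D : Matrix (Fin n) (Fin n) K) i j) ≤ 1)
    (h2 : ∀ i j, Valued.v (((D⁻¹ : GL (Fin n) K) : Matrix (Fin n) (Fin n) K) i j) ≤ 1) :
    siegelLeviLift n K D ∈ symplecticInt (Fin n) K := by
  rw [mem_symplecticInt_iff]
  rintro (i | i) (j | j)
  · rw [siegelLeviLift_apply_inl_inl]; exact h2 j i
  · rw [siegelLeviLift_apply_inl_inr, map_zero]; exact zero_le_one
  · rw [siegelLeviLift_apply_inr_inl, map_zero]; exact zero_le_one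
  · rw [siegelLeviLift_apply_inr_inr]; exact h1 i j

variable {ϖ : K}

/-- **The diagonal of `D(p)` carries MINUS the Iwasawa exponents**: `v(D(p)_{ii}) = exp(a(p)ᵢ)` for `p ∈ B(K)`
(`D(p)_{ii} p_{inl i, inl i} = 1` and `v(p_{inl i, inl i}) = exp(-a(p)ᵢ)`). [cite: CartierCorvallis1979, §IV (4.2)]
[cite: BruhatTits1972, (4.4.3)] -/
theorem v_siegelBlockGL_apply_self (hϖ : Valued.v ϖ = WithZero.exp (-1 : ℤ)) {p : symplecticGroup (Fin n) K}
    (hp : p ∈ symplecticBorel n K) (i : Fin n) :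
    Valued.v (((siegelBlockGL n K ⟨p, symplecticBorel_le_symplecticSiegelParabolic hp⟩ : GL (Fin n) K) : Matrix (Fin n) (Fin n) K) i i) =
      WithZero.exp (symplecticIwasawaExp hϖ p i) := by
  have h1 := siegelBlockGL_apply_self_mul_apply_inl hp i
  have hv := v_apply_inl_eq_exp_neg hϖ hp (symplecticInt (Fin n) K).one_mem (mul_one p).symm i
  have h := congrArg Valued.v h1
  rw [map_mul, map_one, hv] at h
  have hne : WithZero.exp (-symplecticIwasawaExp hϖ p i) ≠ 0 := WithZero.exp_ne_zero
  calc Valued.v (((siegelBlockGL n K ⟨p, symplecticBorel_le_symplecticSiegelParabolic hp⟩ : GL (Fin n) K) : Matrix (Fin n) (Fin n) K) i i)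
      = (WithZero.exp (-symplecticIwasawaExp hϖ p i))⁻¹ := eq_inv_of_mul_eq_one_left h
    _ = WithZero.exp (symplecticIwasawaExp hϖ p i) := by rw [← WithZero.exp_neg, neg_neg]

end Valued

end Literature.NumberTheory.Automorphic.SymplecticCartan

end
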